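import Summits.CriticalPhenomena.PercolationContinuityZ3.Theorems.PercNearOneGluingNoHeavyQuantThreePortBoxKit
import HarnessLib

/-!
# `Z(3,2)` at a three-port observer from the linear three-cluster row (H_κ): the box certificate of the H-chain

builds on p205010 (kernel theorem, internal audit signed; external expert review pending)

Support file (`--supports stmt-CriticalPhenomena-4575`), seat `prim-quant-p1` (gen 39); memo
`run/shared/lean/prim/quant/prim-quant-p1-g39/FOR-LEAD-Z32-HCOLLAR.md`.  No definitions, no named facts, no sorries; standard axioms.
Pure real algebra (imports only the corner bounds `Tm_le_box` / `V_ge_box` / `vacBox_*` of `…QuantThreePortBoxKit`).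

SETTING (`ThreePort`, residual system of `ThreePort.le_one_reached_le_of_cellSolverH`, p551940): hairs `α, β, γ`, off-`o` cells
`U0, Uab, Uac, Ubc, U3 ≥ 0` summing to `1`, the failed exchanges `(gb), (gc)`, the mean row `Σ_v q_v > 2`, and the linear
three-cluster row of p1 g38 at the apex `a`
  (H_κ, apex `a`)   `κ · (Uab + Uac + U3) · (U0 + Uab + Uac) ≤ Uab + Uac`   (`κ·P(a attached)·P(b ↮ c) ≤ P(both)`).
THE H-CHAIN (this file, `ThreePort.hBox_a_false`).  Write `D := Uab + Uac + U3 = P(a attached)`, `S := Uab + Uac`.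
(1) the caps `(gb), (gc)` give `Uac ≤ r_b U0`, `Uab ≤ r_c U0` (`r_v = T_v/V_v`), so `S ≤ R·U0`, `R = r_b + r_c`;
(2) H_κ: `κ D ≤ S/(U0+S) ≤ R/(1+R)`, i.e. `κ D (1+R) ≤ R` — the apex is RARELY ATTACHED;
(3) the mean: with `a' = 1−α, …`, `Σ > 2 ⟺ (a'+b'+c')U0 + (2a'b'+c')Uab + (2a'c'+b')Uac + (2b'c'+a')Ubc + 3a'b'c'·U3 < 1`
    (`sigma_phi_lt_one`), and every coefficient is `≥ m := 2b'c'+a'` resp. `≥ q := 3a'b'c'` (`phi_ge`), so `1 > m(1−D) + qD`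
    — the apex is OFTEN ATTACHED (`D > (m−1)/(m−q)`);
(4) on a hair box all constants have monotone corner values, and ONE numeric condition `R(M−Q) ≤ κ₀(1+R)(M−1)` closes the box.
Also: `sigBox_false` (a box with `q ≥ 1`: `Σ ≤ 2`), `marginBox_false` (a box inside the hair-margin region `V_a ≥ 1/40`, which is
settled by `…QuantThreePortHairMargin` and therefore excluded from the collar).  The tiling of the collar: `…QuantThreePortHTiles`;
assembly and the measure-level theorem: `…QuantThreePortHCollar`.
[cite: Gladkov2024, Thm. 1.3 (p. 2), Conj. 10.1 (p. 18), arXiv:2408.08457] (context: H_κ is the linear form next to these).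
-/

noncomputable section

namespace Summit.CriticalPhenomena.PercolationContinuityZ3.Theorems

namespace ThreePort

/-! ### The mean row in "miss" form -/

/-- `Σ_v q_v > 2` in miss form: `(a'+b'+c')U0 + (2a'b'+c')Uab + (2a'c'+b')Uac + (2b'c'+a')Ubc + 3a'b'c'U3 < 1` (`a' = 1−α`, …),
an identity given `Σ cells = 1`. [this work] -/
theorem sigma_phi_lt_one (α β γ U0 Uab Uac Ubc U3 : ℝ) (hsum : Uab + Uac + Ubc + U3 + U0 = 1)
    (hSig : 2 < (α + β + γ) + (α + β - 2 * α * β) * Uab + (α + γ - 2 * α * γ) * Uac + (β + γ - 2 * β * γ) * Ubc +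
      ((1 - α) * (β + γ - β * γ) + (1 - β) * (α + γ - α * γ) + (1 - γ) * (α + β - α * β)) * U3) :
    ((1 - α) + (1 - β) + (1 - γ)) * U0 + (2 * (1 - α) * (1 - β) + (1 - γ)) * Uab + (2 * (1 - α) * (1 - γ) + (1 - β)) * Uac +
      (2 * (1 - β) * (1 - γ) + (1 - α)) * Ubc + 3 * (1 - α) * (1 - β) * (1 - γ) * U3 < 1 := by
  have e : ((α + β + γ) + (α + β - 2 * α * β) * Uab + (α + γ - 2 * α * γ) * Uac + (β + γ - 2 * β * γ) * Ubc +
      ((1 - α) * (β + γ - β * γ) + (1 - β) * (α + γ - α * γ) + (1 - γ) * (α + β - α * β)) * U3) +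
      (((1 - α) + (1 - β) + (1 - γ)) * U0 + (2 * (1 - α) * (1 - β) + (1 - γ)) * Uab + (2 * (1 - α) * (1 - γ) + (1 - β)) * Uac +
      (2 * (1 - β) * (1 - γ) + (1 - α)) * Ubc + 3 * (1 - α) * (1 - β) * (1 - γ) * U3) =
      3 + (3 - (α + β + γ)) * (Uab + Uac + Ubc + U3 + U0 - 1) := by ring
  have e2 : (3 - (α + β + γ)) * (Uab + Uac + Ubc + U3 + U0 - 1) = 0 := by rw [hsum]; ring
  linarith only [hSig, e, e2]

/-- Lower bound of the miss form on a hair box: with `M = 2(1−hb)(1−hc) + (1−ha)`, `Q = 3(1−ha)(1−hb)(1−hc)` (corner values at the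
largest hairs), the miss form is `≥ M·(U0 + Ubc) + Q·(Uab + Uac + U3)` (all coefficients are monotone; `2a'b'+c' ≥ 3a'b'c'` and
`a'+b'+c' ≥ 2b'c'+a'` on `[0,1]³`). [this work] -/
theorem phi_ge (α β γ U0 Uab Uac Ubc U3 ha hb hc : ℝ) (a2 : α ≤ ha) (b2 : β ≤ hb) (c2 : γ ≤ hc)
    (hα0 : 0 ≤ α) (hβ0 : 0 ≤ β) (hγ0 : 0 ≤ γ) (hha : ha ≤ 1) (hhb : hb ≤ 1) (hhc : hc ≤ 1)
    (h0 : 0 ≤ U0) (hab : 0 ≤ Uab) (hac : 0 ≤ Uac) (hbc : 0 ≤ Ubc) (h3 : 0 ≤ U3) :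
    (2 * (1 - hb) * (1 - hc) + (1 - ha)) * (U0 + Ubc) + 3 * (1 - ha) * (1 - hb) * (1 - hc) * (Uab + Uac + U3) ≤
    ((1 - α) + (1 - β) + (1 - γ)) * U0 + (2 * (1 - α) * (1 - β) + (1 - γ)) * Uab + (2 * (1 - α) * (1 - γ) + (1 - β)) * Uac +
      (2 * (1 - β) * (1 - γ) + (1 - α)) * Ubc + 3 * (1 - α) * (1 - β) * (1 - γ) * U3 := by
  -- monotone corner bounds
  have hb' : 1 - hb ≤ 1 - β := by linarith only [b2]
  have hc' : 1 - hc ≤ 1 - γ := by linarith only [c2]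
  have ha' : 1 - ha ≤ 1 - α := by linarith only [a2]
  have hbc' : (1 - hb) * (1 - hc) ≤ (1 - β) * (1 - γ) :=
    mul_le_mul hb' hc' (by linarith only [hhc]) (by linarith only [hβ0, b2, hhb, hb'])
  have hM : 2 * (1 - hb) * (1 - hc) + (1 - ha) ≤ 2 * (1 - β) * (1 - γ) + (1 - α) := by nlinarith only [hbc', ha']
  have hQ : 3 * (1 - ha) * (1 - hb) * (1 - hc) ≤ 3 * (1 - α) * (1 - β) * (1 - γ) := by
    have h1 : (1 - ha) * ((1 - hb) * (1 - hc)) ≤ (1 - α) * ((1 - β) * (1 - γ)) :=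
      mul_le_mul ha' hbc' (mul_nonneg (by linarith only [hhb]) (by linarith only [hhc])) (by linarith only [hα0, a2, hha, ha'])
    nlinarith only [h1]
  -- coefficient comparisons on `[0,1]³`
  have hα1 : α ≤ 1 := a2.trans hha
  have hβ1 : β ≤ 1 := b2.trans hhb
  have hγ1 : γ ≤ 1 := c2.trans hhc
  have k1 : 2 * (1 - β) * (1 - γ) + (1 - α) ≤ (1 - α) + (1 - β) + (1 - γ) := by
    have : 0 ≤ (1 - β) * γ + (1 - γ) * β := by nlinarith only [hβ0, hβ1, hγ0, hγ1]
    nlinarith only [this]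
  have k2 : 3 * (1 - α) * (1 - β) * (1 - γ) ≤ 2 * (1 - α) * (1 - β) + (1 - γ) := by
    -- `2a'b' + c' − 3a'b'c' = c'(1 − a'b') + 2a'b'(1 − c')`
    have h1 : 0 ≤ (1 - γ) * (1 - (1 - α) * (1 - β)) := mul_nonneg (by linarith only [hγ1]) (by nlinarith only [hα0, hα1, hβ0, hβ1])
    have h2 : 0 ≤ (1 - α) * (1 - β) * γ := mul_nonneg (mul_nonneg (by linarith only [hα1]) (by linarith only [hβ1])) hγ0
    nlinarith only [h1, h2]
  have k3 : 3 * (1 - α) * (1 - β) * (1 - γ) ≤ 2 * (1 - α) * (1 - γ) + (1 - β) := by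
    have h1 : 0 ≤ (1 - β) * (1 - (1 - α) * (1 - γ)) := mul_nonneg (by linarith only [hβ1]) (by nlinarith only [hα0, hα1, hγ0, hγ1])
    have h2 : 0 ≤ (1 - α) * (1 - γ) * β := mul_nonneg (mul_nonneg (by linarith only [hα1]) (by linarith only [hγ1])) hβ0
    nlinarith only [h1, h2]
  -- termwise
  have t0 : (2 * (1 - hb) * (1 - hc) + (1 - ha)) * U0 ≤ ((1 - α) + (1 - β) + (1 - γ)) * U0 :=
    mul_le_mul_of_nonneg_right (hM.trans k1) h0
  have tbc : (2 * (1 - hb) * (1 - hc) + (1 - ha)) * Ubc ≤ (2 * (1 - β) * (1 - γ) + (1 - α)) * Ubc :=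
    mul_le_mul_of_nonneg_right hM hbc
  have tab : 3 * (1 - ha) * (1 - hb) * (1 - hc) * Uab ≤ (2 * (1 - α) * (1 - β) + (1 - γ)) * Uab :=
    mul_le_mul_of_nonneg_right (hQ.trans k2) hab
  have tac : 3 * (1 - ha) * (1 - hb) * (1 - hc) * Uac ≤ (2 * (1 - α) * (1 - γ) + (1 - β)) * Uac :=
    mul_le_mul_of_nonneg_right (hQ.trans k3) hac
  have t3 : 3 * (1 - ha) * (1 - hb) * (1 - hc) * U3 ≤ 3 * (1 - α) * (1 - β) * (1 - γ) * U3 :=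
    mul_le_mul_of_nonneg_right hQ h3
  nlinarith only [t0, tbc, tab, tac, t3]

/-! ### Box certificates -/

/-- A box on which `Q = 3(1−ha)(1−hb)(1−hc) ≥ 1` (and `M ≥ 1`): the mean row alone is contradictory (`Σ ≤ 2`). [this work] -/
theorem sigBox_false (α β γ U0 Uab Uac Ubc U3 la ha lb hb lc hc : ℝ)
    (a1 : la ≤ α) (a2 : α ≤ ha) (b1 : lb ≤ β) (b2 : β ≤ hb) (c1 : lc ≤ γ) (c2 : γ ≤ hc)
    (h0 : 0 ≤ U0) (hab : 0 ≤ Uab) (hac : 0 ≤ Uac) (hbc : 0 ≤ Ubc) (h3 : 0 ≤ U3)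
    (hsum : Uab + Uac + Ubc + U3 + U0 = 1)
    (hSig : 2 < (α + β + γ) + (α + β - 2 * α * β) * Uab + (α + γ - 2 * α * γ) * Uac + (β + γ - 2 * β * γ) * Ubc +
      ((1 - α) * (β + γ - β * γ) + (1 - β) * (α + γ - α * γ) + (1 - γ) * (α + β - α * β)) * U3)
    (hnum : 0 ≤ la ∧ 0 ≤ lb ∧ 0 ≤ lc ∧ ha ≤ 1 ∧ hb ≤ 1 ∧ hc ≤ 1 ∧
      1 ≤ 3 * (1 - ha) * (1 - hb) * (1 - hc) ∧ 1 ≤ 2 * (1 - hb) * (1 - hc) + (1 - ha)) : False := by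
  obtain ⟨hla, hlb, hlc, hha, hhb, hhc, hQ1, hM1⟩ := hnum
  have hlt := sigma_phi_lt_one α β γ U0 Uab Uac Ubc U3 hsum hSig
  have hge := phi_ge α β γ U0 Uab Uac Ubc U3 ha hb hc a2 b2 c2 (hla.trans a1) (hlb.trans b1) (hlc.trans c1) hha hhb hhc
    h0 hab hac hbc h3
  have h1 : 1 * (U0 + Ubc) ≤ (2 * (1 - hb) * (1 - hc) + (1 - ha)) * (U0 + Ubc) :=
    mul_le_mul_of_nonneg_right hM1 (by linarith only [h0, hbc])
  have h2 : 1 * (Uab + Uac + U3) ≤ 3 * (1 - ha) * (1 - hb) * (1 - hc) * (Uab + Uac + U3) :=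
    mul_le_mul_of_nonneg_right hQ1 (by linarith only [hab, hac, h3])
  linarith only [hlt, hge, h1, h2, hsum]

/-- A box inside the hair-margin region: `V_a = β+γ−βγ−α ≥ 1/40` there (corner bound), contradicting `V_a < 1/40`. [this work] -/
theorem marginBox_false (α β γ ha lb lc : ℝ) (a2 : α ≤ ha) (b1 : lb ≤ β) (c1 : lc ≤ γ) (hγ1 : γ ≤ 1)
    (hVa : β + γ - β * γ - α < 1 / 40) (hnum : lb ≤ 1 ∧ 1 / 40 ≤ lb + lc - lb * lc - ha) : False := by
  have := V_ge_box α β γ ha lb lc a2 b1 c1 hγ1 hnum.1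
  linarith only [this, hVa, hnum.2]

/-- The endgame of the H-chain: `κ D (1+R) ≤ R`, `1 > M(1−D) + Q·D` (`0 ≤ D ≤ 1`), `0 < κ₀ ≤ κ`, `1 ≤ M` and
`R(M−Q) ≤ κ₀(1+R)(M−1)` are contradictory. [this work] -/
theorem h_endgame (κ κ0 D R M Q : ℝ) (hκ : κ0 ≤ κ) (hκ0 : 0 < κ0) (hR : 0 ≤ R) (hD0 : 0 ≤ D)
    (hH : κ * D * (1 + R) ≤ R) (hΦ : M * (1 - D) + Q * D < 1) (hM : 1 ≤ M)
    (hnum : R * (M - Q) ≤ κ0 * (1 + R) * (M - 1)) : False := by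
  rcases le_or_gt Q M with hQM | hQM
  · -- `D(M−Q) ≤ M − 1`
    have h1 : κ0 * D * (1 + R) ≤ R := by
      have : κ0 * D * (1 + R) ≤ κ * D * (1 + R) := by
        have := mul_le_mul_of_nonneg_right hκ (mul_nonneg hD0 (by linarith only [hR] : (0:ℝ) ≤ 1 + R))
        nlinarith only [this]
      exact this.trans hH
    have h2 : κ0 * D * (1 + R) * (M - Q) ≤ R * (M - Q) := mul_le_mul_of_nonneg_right h1 (by linarith only [hQM])
    have h3 : κ0 * (1 + R) * (D * (M - Q)) ≤ κ0 * (1 + R) * (M - 1) := by nlinarith only [h2, hnum]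
    have hpos : 0 < κ0 * (1 + R) := mul_pos hκ0 (by linarith only [hR])
    have h4 : D * (M - Q) ≤ M - 1 := le_of_mul_le_mul_left h3 hpos
    nlinarith only [hΦ, h4]
  · have : 0 ≤ D * (Q - M) := mul_nonneg hD0 (by linarith only [hQM])
    nlinarith only [hΦ, this, hM]

set_option maxHeartbeats 800000 in
/-- **H-chain box certificate, apex `a`.**  On the hair box `[la,ha]×[lb,hb]×[lc,hc] ⊆ [0,1]³`, the residual rows
(cells, the failed exchanges at `b` and `c`, the mean) together with the linear three-cluster row H_κ at the apex `a`
(`κ ≥ κ₀ > 0`) are contradictory as soon as the numeric condition `hnum` holds: `Uac ≤ RB·U0`, `Uab ≤ RC·U0` (corner cap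
ratios), `κ·D·(1+R) ≤ R` with `D = Uab+Uac+U3`, `R = RB+RC`, against `1 > M(1−D) + QD` from the mean. [this work] -/
theorem hBox_a_false (κ κ0 α β γ U0 Uab Uac Ubc U3 la ha lb hb lc hc RB RC : ℝ) (hκ : κ0 ≤ κ)
    (a1 : la ≤ α) (a2 : α ≤ ha) (b1 : lb ≤ β) (b2 : β ≤ hb) (c1 : lc ≤ γ) (c2 : γ ≤ hc)
    (h0 : 0 ≤ U0) (hab : 0 ≤ Uab) (hac : 0 ≤ Uac) (hbc : 0 ≤ Ubc) (h3 : 0 ≤ U3)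
    (hsum : Uab + Uac + Ubc + U3 + U0 = 1)
    (gb : U0 * ((1 - β) * α * γ - β * (1 - α) * (1 - γ)) + Uac * (α + γ - α * γ - β) < 0)
    (gc : U0 * ((1 - γ) * α * β - γ * (1 - α) * (1 - β)) + Uab * (α + β - α * β - γ) < 0)
    (hHa : κ * (Uab + Uac + U3) * (U0 + Uab + Uac) ≤ Uab + Uac)
    (hSig : 2 < (α + β + γ) + (α + β - 2 * α * β) * Uab + (α + γ - 2 * α * γ) * Uac + (β + γ - 2 * β * γ) * Ubc +
      ((1 - α) * (β + γ - β * γ) + (1 - β) * (α + γ - α * γ) + (1 - γ) * (α + β - α * β)) * U3)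
    (hnum : 0 ≤ la ∧ 0 ≤ lb ∧ 0 ≤ lc ∧ ha ≤ 1 ∧ hb ≤ 1 ∧ hc ≤ 1 ∧
      0 < la + lc - la * lc - hb ∧ hb * (1 - la) * (1 - lc) - (1 - hb) * la * lc ≤ RB * (la + lc - la * lc - hb) ∧ 0 ≤ RB ∧
      0 < la + lb - la * lb - hc ∧ hc * (1 - la) * (1 - lb) - (1 - hc) * la * lb ≤ RC * (la + lb - la * lb - hc) ∧ 0 ≤ RC ∧
      0 < κ0 ∧ 1 ≤ 2 * (1 - hb) * (1 - hc) + (1 - ha) ∧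
      (RB + RC) * ((2 * (1 - hb) * (1 - hc) + (1 - ha)) - 3 * (1 - ha) * (1 - hb) * (1 - hc)) ≤
        κ0 * (1 + (RB + RC)) * ((2 * (1 - hb) * (1 - hc) + (1 - ha)) - 1)) : False := by
  obtain ⟨hla, hlb, hlc, hha, hhb, hhc, hVB, hTB, hRB, hVC, hTC, hRC, hκ0, hM1, hfin⟩ := hnum
  set TB : ℝ := hb * (1 - la) * (1 - lc) - (1 - hb) * la * lc with hTBd
  set VB : ℝ := la + lc - la * lc - hb with hVBd
  set TC : ℝ := hc * (1 - la) * (1 - lb) - (1 - hc) * la * lb with hTCd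
  set VC : ℝ := la + lb - la * lb - hc with hVCd
  set M : ℝ := 2 * (1 - hb) * (1 - hc) + (1 - ha) with hMd
  set Q : ℝ := 3 * (1 - ha) * (1 - hb) * (1 - hc) with hQd
  have hα0 : 0 ≤ α := hla.trans a1
  have hβ0 : 0 ≤ β := hlb.trans b1
  have hγ0 : 0 ≤ γ := hlc.trans c1
  have hγ1 : γ ≤ 1 := c2.trans hhc
  have hβ1 : β ≤ 1 := b2.trans hhb
  -- corner bounds for the caps at `b` and `c`
  have hT_b : β * (1 - α) * (1 - γ) - (1 - β) * α * γ ≤ TB :=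
    Tm_le_box β α γ lb hb la ha lc hc b1 b2 a1 a2 c1 c2 hlb hla hlc hhb hha hhc
  have hV_b : VB ≤ α + γ - α * γ - β := V_ge_box β α γ hb la lc b2 a1 c1 hγ1 (a1.trans (a2.trans hha))
  have hT_c : γ * (1 - α) * (1 - β) - (1 - γ) * α * β ≤ TC :=
    Tm_le_box γ α β lc hc la ha lb hb c1 c2 a1 a2 b1 b2 hlc hla hlb hhc hha hhb
  have hV_c : VC ≤ α + β - α * β - γ := V_ge_box γ α β hc la lb c2 a1 b1 hβ1 (a1.trans (a2.trans hha))
  have gb' : Uac * (α + γ - α * γ - β) < U0 * (β * (1 - α) * (1 - γ) - (1 - β) * α * γ) := by linarith only [gb]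
  have gc' : Uab * (α + β - α * β - γ) < U0 * (γ * (1 - α) * (1 - β) - (1 - γ) * α * β) := by linarith only [gc]
  -- `Uac ≤ RB U0`, `Uab ≤ RC U0`
  have hUac : Uac ≤ RB * U0 := by
    have h1 : Uac * VB ≤ Uac * (α + γ - α * γ - β) := mul_le_mul_of_nonneg_left hV_b hac
    have h2 : U0 * (β * (1 - α) * (1 - γ) - (1 - β) * α * γ) ≤ U0 * TB := mul_le_mul_of_nonneg_left hT_b h0
    have h3' : U0 * TB ≤ U0 * (RB * VB) := mul_le_mul_of_nonneg_left hTB h0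
    have h4 : Uac * VB ≤ (RB * U0) * VB := by nlinarith only [h1, h2, h3', gb']
    exact le_of_mul_le_mul_right h4 hVB
  have hUab : Uab ≤ RC * U0 := by
    have h1 : Uab * VC ≤ Uab * (α + β - α * β - γ) := mul_le_mul_of_nonneg_left hV_c hab
    have h2 : U0 * (γ * (1 - α) * (1 - β) - (1 - γ) * α * β) ≤ U0 * TC := mul_le_mul_of_nonneg_left hT_c h0
    have h3' : U0 * TC ≤ U0 * (RC * VC) := mul_le_mul_of_nonneg_left hTC h0
    have h4 : Uab * VC ≤ (RC * U0) * VC := by nlinarith only [h1, h2, h3', gc']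
    exact le_of_mul_le_mul_right h4 hVC
  have hU0 : 0 < U0 := by
    rcases h0.lt_or_eq with h | h
    · exact h
    · exfalso
      have h1 : 0 ≤ Uac * (α + γ - α * γ - β) := mul_nonneg hac (by linarith only [hV_b, hVB])
      rw [← h, zero_mul] at gb'
      exact absurd gb' (not_lt.2 h1)
  -- the H row: `κ D (1+R) ≤ R`
  set S : ℝ := Uab + Uac with hSd
  set D : ℝ := Uab + Uac + U3 with hDd
  set R : ℝ := RB + RC with hRd
  have hR0 : 0 ≤ R := by rw [hRd]; linarith only [hRB, hRC]
  have hS : S ≤ R * U0 := by rw [hSd, hRd]; linarith only [hUac, hUab]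
  have hD0 : 0 ≤ D := by rw [hDd]; linarith only [hab, hac, h3]
  have hHa' : κ * D * (U0 + S) ≤ S := by rw [hDd, hSd]; linarith only [hHa]
  have hH : κ * D * (1 + R) ≤ R := by
    have h1 : κ * D * (U0 + S) * (1 + R) ≤ S * (1 + R) := mul_le_mul_of_nonneg_right hHa' (by linarith only [hR0])
    have h2 : S * (1 + R) ≤ R * (U0 + S) := by nlinarith only [hS, hR0]
    have h3' : (U0 + S) * (κ * D * (1 + R)) ≤ (U0 + S) * R := by nlinarith only [h1, h2]
    exact le_of_mul_le_mul_left h3' (by rw [hSd]; linarith only [hU0, hab, hac])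
  -- the mean row: `1 > M(1−D) + Q D`
  have hlt := sigma_phi_lt_one α β γ U0 Uab Uac Ubc U3 hsum hSig
  have hge := phi_ge α β γ U0 Uab Uac Ubc U3 ha hb hc a2 b2 c2 hα0 hβ0 hγ0 hha hhb hhc h0 hab hac hbc h3
  have hΦ : M * (1 - D) + Q * D < 1 := by
    have e : U0 + Ubc = 1 - D := by rw [hDd]; linarith only [hsum]
    rw [← e]; linarith only [hlt, hge]
  exact h_endgame κ κ0 D R M Q hκ hκ0 hR0 hD0 hH hΦ hM1 hfin

end ThreePort

end Summit.CriticalPhenomena.PercolationContinuityZ3.Theorems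

end
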